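import Summits.AtomisticToContinuum.BoseEinsteinCondensation.Theorems.BECStronglyRayleighLatticeToPeriodicBridgeCoarseCellDefs
import Summits.AtomisticToContinuum.BoseEinsteinCondensation.Theorems.BECStronglyRayleighLatticeToPeriodicBridgeDiluteEnergyCeiling
import Summits.AtomisticToContinuum.BoseEinsteinCondensation.Theorems.BECStronglyRayleighLatticeToPeriodicBridgeCellNormRetention
import Summits.AtomisticToContinuum.BoseEinsteinCondensation.Theorems.BECStronglyRayleighLatticeToPeriodicBridgeCellPairSumRule
import Summits.AtomisticToContinuum.BoseEinsteinCondensation.Theorems.BECStronglyRayleighLatticeToPeriodicBridgePositiveTransfer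
import Summits.AtomisticToContinuum.BoseEinsteinCondensation.Theorems.BECStronglyRayleighLatticeToPeriodicBridgeRowFlatnessSandwich
import Summits.AtomisticToContinuum.BoseEinsteinCondensation.Theorems.BECStronglyRayleighLatticeToPeriodicBridgePairFromSingle

/-!
# Line `coarse-cell-lorentzian` — skeleton for crux `LatticeToPeriodicBridge` (stmt-AtomisticToContinuum-9674)
# LEAD'S RESHAPE v6 (kept lineage-0 seat prover-line-stmt-AtomisticToContinuum-9674-c1-0, 2026-08-16): the IMPORT form of v3
# (the four landed stub modules are built on the farm and imported instead of inlined) + the landed SANDWICH modules (p96926,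
# p100267, PairFromSingle); stub set and composition UNCHANGED; section `Sandwich` exhibits both directions around the residual stub S45.

Route `route-AtomisticToContinuum-BECStronglyRayleigh` (rank-4 crux); crux decl
`Summit.AtomisticToContinuum.BoseEinsteinCondensation.Theses.BECStronglyRayleigh.LatticeToPeriodicBridge`
(`KineticLatticeBEC → PeriodicBEC-body`), concluded BY NAME by `LatticeToPeriodicBridge_of` below.

## What is in the tree (all sorry-free, `--supports stmt-AtomisticToContinuum-9674`)

* `Theorems/BECStronglyRayleighLatticeToPeriodicBridgeCoarseCellDefs.lean` (p87338): vocabulary (`torusCell`, `pairConfig`,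
  `cellKernel`, `cellField`, `kernelMass`, `fieldMoment`, `fieldMass`, `PeriodicBECAt`), the six planner stub statements
  `Sig.stub_*`, the merged open statement `Sig.stub_pairKernelRowFlatness` (S45) and the glue `Sig.stub_pairKernelRowFlatness_of :
  S4 → S5 → S45`; sanity lemmas `moment_le_two_mul_mass`, `flatKernel_halfSlack`.
* S1 `stub_diluteEnergyCeiling` — `…DiluteEnergyCeiling.lean` (p89510): `E₀^per(N, L_N) ≤ CρN` eventually (LSSY Thm 2.2).
* S2 `stub_cellNormRetention` — `…CellNormRetention.lean` (p90378; helpers `…CellPoincare` p84619, `…CellPairSplit` p84667):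
  `I_K ≥ b⁶(1 − 2b²E/(N'+2))`.
* S3 `stub_cellPairSumRule` — `…CellPairSumRule.lean` (p90557): `n₀ ≥ (N'+2)·M⁻³·b⁻⁶·I_r`.
* S6 `stub_positiveTransfer` — `…PositiveTransfer.lean` (p90374), conditional on the route items `BECLiebAntibunching.PeriodicRigidity`
  (stmt-9467) and `BECCountConvexity.PositivePeriodicNearMinimiser` (stmt-14006) BY NAME.
* (this seat) `…PairSlotMeans.lean` (p100267) + `…PairFromSingle.lean` (p103808): many-slot Cauchy–Schwarz `⟨n̂₀⟩² ≤ ⟨n̂₀²⟩` in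
  integrals and `CondensateFloor → Sig.stub_pairKernelRowFlatness` (registered sub-goal `rowFlatnessSandwich_condensateFloor`);
  `…FewBodyCondensation.lean` (p102748): few bosons on a large torus are `2/3`-condensed; `…PlainCondensateFloor.lean`: a PLAIN uniform
  floor `n₀ ≥ cN` for the real `≥ 0` near-minimisers → S45 (registered sub-goal `rowFlatnessSandwich_plainFloor`).
* (this seat) `…RowFlatnessSandwich.lean` (p96926 ACCEPTED, commit 13fb98131699): `I_K ≤ b⁶`, `∫_{X'}(∫_{cell²}Re Ψ)² ≤ M³·I_r`, hence
  `PairCondensateFloor → Sig.stub_pairKernelRowFlatness` (registered sub-goal `rowFlatnessSandwich_pairFloor`): the CONVERSE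
  bookkeeping — S45 follows from pair torus BEC of the real `≥ 0` near-minimisers alone (no lattice, no signature, no Poincaré).

## What is open (registered stubs of this file) and the lead's verdict

* `stub_pairKernelRowFlatness : Sig.stub_pairKernelRowFlatness` (S45) — `M³·I_K ≤ 𝕄·I_r` for real `≥ 0` near-minimisers,
  uniformly in `M`. SANDWICHED: S45 ⟹ torus BEC of the real `≥ 0` near-minimisers (`periodicBEC_of` below, with S1–S3) and
  PairCondensateFloor ⟹ S45 (`RowFlatnessSandwich`), where the pair floor `⟨P₀⊗P₀⊗1⟩ ≥ 1/𝕄` is ordinary torus BEC up to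
  `⟨n̂₀²⟩ ≥ ⟨n̂₀⟩²`. So S45 is the consequent of the crux coarse-grained — crux-sized by identity, not by difficulty estimate.
* `stub_integratedPairCoherence` (S4, Lorentzian lever) and `stub_cellInsertionDelocalisation` (S5, rank-3 twin) remain the
  planner's structured route S4 ∧ S5 ⇒ S45 (`LatticeToPeriodicBridge_of_lever`); S5 is BEC-strength by the same sandwich one level
  down (field instead of kernel), S4 has no continuum engine (bondwise Borcea–Brändén dies off-lattice; "Theorem S, soft-core
  form" is NOT DECOMPOSED in the route).

## Composition (kernel-checked; `periodicBEC_of`) — unchanged from v3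

`b⁶/2 ≤ I_K` (S1 + S2, retention ≥ ½ once `ρ ≤ 1/(32b₁²(C+1))`, `N ≥ 32b₁²`) and `M³I_K ≤ 𝕄I_r` (S45) give `I_r ≥ M³b⁶/(4𝕄)`,
S3 gives `n₀ ≥ N/(4𝕄)` for real non-negative `δ₁`-near-minimisers (`δ₁ = min(δ₅, 1)` chosen AFTER `(N, L, M)`), S6 gives
`n₀ ≥ N/(16𝕄)` for all `δ`-near-minimisers, for every repulsive finite-range `v` and `ρ < ρ₀(v)`, `M = ⌊L_N/b₁⌋`: the consequent
(`PeriodicBECAt v`); `LatticeToPeriodicBridge_of` discards the antecedent. Final shape: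
`LatticeToPeriodicBridge ⟸ stub_pairKernelRowFlatness ∧ PeriodicRigidity (9467) ∧ PositivePeriodicNearMinimiser (14006)`.

## Disproof.lean (gen 2 FINAL) and drefute honoured — unchanged (no `_false_without_`; no window certificate; `ρ₀` depends on `v`;
drefute j012978: 0 stub-false / 0 stub-misstated on S1–S6; S45 carries `0 ≤ re` and reality as load-bearing hypotheses).
-/

noncomputable section

open MeasureTheory Filter
open scoped ENNReal Topology

namespace Summit.AtomisticToContinuum.BoseEinsteinCondensation.Cruxes.LatticeToPeriodicBridge.CoarseCellLorentzian

open Literature.MathematicalPhysics.QuantumManyBody.BoseGas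
open Literature.Barriers.AtomisticToContinuum.BoseGas
open Summit.AtomisticToContinuum.BoseEinsteinCondensation.Theses
open Summit.AtomisticToContinuum.BoseEinsteinCondensation.Theses.BECStronglyRayleigh

/-! ## Registered stubs (lead reshape v3 = v4, 2026-08-16)

LANDED (imported above, sorry-free, `--supports stmt-AtomisticToContinuum-9674`): `stub_diluteEnergyCeiling` (S1),
`stub_cellNormRetention` (S2, with helpers `…CellPoincare`, `…CellPairSplit`), `stub_cellPairSumRule` (S3), `stub_positiveTransfer`
(S6, conditional on `PeriodicRigidity` 9467 + `PositivePeriodicNearMinimiser` 14006 by name). OPEN: the single merged stub below —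
the composition consumed the planner's S4 (`Sig.stub_integratedPairCoherence`, the Lorentzian lever) and S5
(`Sig.stub_cellInsertionDelocalisation`) only through their product `M³·I_K ≤ 2𝕄·I_r` (drefuter's remark 2,
`DrefuteCoarseCellLorentzian.md`), so the open content is registered as ONE weaker statement, row flatness of the conditional
cell-pair kernels; S4 ∧ S5 still imply it (`Sig.stub_pairKernelRowFlatness_of`, Defs file), so either route closes the crux. -/

/-- Registered stub S45 (row flatness of the conditional cell-pair kernels; OPEN, BEC-strength — the line's one SUFFICIENT
remaining obligation; its lattice twin `L³Σ_T‖K_T‖_F² ≤ 𝕄 Σ_T‖K_T𝟙‖²` is, by `PairKernelSumRule`, exactly `KineticLatticeBEC`). -/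
theorem stub_pairKernelRowFlatness : Sig.stub_pairKernelRowFlatness := by
  sorry

/-- Registered stub S4 (the planner's Lorentzian LEVER; OPEN structural conjecture, ED-testable; optional: with S5 it implies S45). -/
theorem stub_integratedPairCoherence : Sig.stub_integratedPairCoherence := by
  sorry

/-- Registered stub S5 (the planner's HARDEST: delocalisation of the cell pair-insertion FIELD; OPEN, rank-3 twin; optional: with
S4 it implies S45). -/
theorem stub_cellInsertionDelocalisation : Sig.stub_cellInsertionDelocalisation := by
  sorry

/-! ## Composition (sorry-free) -/

set_option maxHeartbeats 400000 in
/-- **The coarse-cell assembly** (v3: merged open stub): the five statements give the consequent of the crux for EVERY repulsive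
finite-range `v`, with `ρ₀ = min(ρ₁, ρ_d, ρ_r, 1/(32b_*²(C+1)))`, `b_* = b₁`, `M = ⌊L_N/b_*⌋`
(so `b = L_N/M ∈ [b_*, 2b_*]`), `δ₁ = min(δ₄, δ₅, 1)`, `c = 1/(16𝕄)`. Real arithmetic: retention `≥ ½`, then
`b⁶/2 ≤ I_K ≤ 2I_F ≤ 2𝕄I_r/M³`, so `N·M⁻³b⁻⁶I_r ≥ N/(4𝕄)`; S3 turns this into `n₀ ≥ N/(4𝕄)` for real
non-negative `δ₁`-near-minimisers and S6 into `n₀ ≥ N/(16𝕄)` for all `δ`-near-minimisers. -/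
theorem periodicBEC_of (h1 : Sig.stub_diluteEnergyCeiling) (h2 : Sig.stub_cellNormRetention)
    (h3 : Sig.stub_cellPairSumRule) (h45 : Sig.stub_pairKernelRowFlatness) (h6 : Sig.stub_positiveTransfer)
    (hR : BECLiebAntibunching.PeriodicRigidity) (hP : BECCountConvexity.PositivePeriodicNearMinimiser)
    (v : ℝ → ℝ≥0∞) (hv : IsRepulsiveFiniteRange v) : PeriodicBECAt v := by
  -- constants of the line
  obtain ⟨C_E, hC_E, ρ₁, hρ₁, hE⟩ := h1 v hv
  obtain ⟨𝕄, h𝕄, b₁, hb₁, ρd, hρd, hdel⟩ := h45 v hv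
  obtain ⟨ρr, hρr, htr⟩ := h6 hR hP v hv
  -- one cell scale `bs = b₁` and one density `ρd` from the merged stub
  set bs : ℝ := b₁ with hbs_def
  have hbs : 0 < bs := hb₁
  have hbs0 : bs ≠ 0 := hbs.ne'
  set ρret : ℝ := 1 / (32 * bs ^ 2 * (C_E + 1)) with hρret_def
  have hρret : 0 < ρret := by positivity
  unfold PeriodicBECAt
  refine ⟨min (min ρ₁ (min ρd ρr)) ρret, lt_min (lt_min hρ₁ (lt_min hρd hρr)) hρret, fun ρ hρ hρlt => ?_⟩
  have hρ_1 : ρ < ρ₁ := hρlt.trans_le ((min_le_left _ _).trans (min_le_left _ _))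
  have hρ_d : ρ < ρd := hρlt.trans_le ((min_le_left _ _).trans ((min_le_right _ _).trans (min_le_left _ _)))
  have hρ_r : ρ < ρr := hρlt.trans_le ((min_le_left _ _).trans ((min_le_right _ _).trans (min_le_right _ _)))
  have hρ_ret : ρ < ρret := hρlt.trans_le (min_le_right _ _)
  -- the level reached for real non-negative near-minimisers
  set c₁ : ℝ := 1 / (4 * 𝕄) with hc₁_def
  have hc₁ : 0 < c₁ := by positivity
  refine ⟨c₁ / 4, by positivity, ?_⟩
  -- eventually in N
  have hevL : ∀ᶠ N : ℕ in atTop, 2 * bs ≤ sideLength ρ N :=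
    (tendsto_sideLength_atTop hρ).eventually_ge_atTop (2 * bs)
  have hevN : ∀ᶠ N : ℕ in atTop, 32 * bs ^ 2 ≤ (N : ℝ) :=
    tendsto_natCast_atTop_atTop.eventually_ge_atTop (32 * bs ^ 2)
  filter_upwards [eventually_ge_atTop 2, hevL, hevN, hE ρ hρ hρ_1, htr ρ hρ hρ_r c₁ hc₁]
    with N hN2 hLN hN32 hEN htrN
  -- write N = N' + 2
  obtain ⟨N', rfl⟩ : ∃ N', N = N' + 2 := ⟨N - 2, by omega⟩
  have hNpos : 0 < N' + 2 := by omega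
  set L : ℝ := sideLength ρ (N' + 2) with hL_def
  have hL : 0 < L := sideLength_pos_of_pos hρ hNpos
  -- number of cells per side and the cell size b = L/M ∈ [bs, 2bs]
  set M : ℕ := ⌊L / bs⌋₊ with hM_def
  have hLbs : (2 : ℝ) ≤ L / bs := by
    rw [le_div_iff₀ hbs]; exact hLN
  have hM2 : 2 ≤ M := Nat.le_floor (by exact_mod_cast hLbs)
  have hM1 : 1 ≤ M := le_trans (by norm_num) hM2
  have hMpos : (0 : ℝ) < M := by exact_mod_cast (lt_of_lt_of_le (by norm_num) hM2 : 0 < M)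
  have hM2r : (2 : ℝ) ≤ M := by exact_mod_cast hM2
  have hMle : (M : ℝ) ≤ L / bs := Nat.floor_le (by positivity)
  have hMlt : L / bs < (M : ℝ) + 1 := Nat.lt_floor_add_one _
  have hb_lo : bs ≤ L / M := by
    rw [le_div_iff₀ hMpos]
    calc bs * M ≤ bs * (L / bs) := mul_le_mul_of_nonneg_left hMle hbs.le
      _ = L := by rw [mul_comm]; exact div_mul_cancel₀ L hbs0
  have hb_hi : L / M ≤ 2 * bs := by
    rw [div_le_iff₀ hMpos]
    have h1 : L < (↑M + 1) * bs := by rwa [div_lt_iff₀ hbs] at hMlt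
    nlinarith only [h1, mul_nonneg hbs.le (sub_nonneg.2 hM2r), hbs.le]
  have hb1' : b₁ ≤ L / M := hb_lo
  have hbpos : 0 < L / M := hbs.trans_le hb_lo
  -- density hypotheses: N' + 2 = ρ L³
  have hNρ : ((N' : ℝ) + 2) = ρ * L ^ 3 := by
    have h := natCast_eq_mul_sideLength_pow_three hρ hNpos
    push_cast at h
    exact h
  have hL3 : (0 : ℝ) ≤ L ^ 3 := by positivity
  have hdens_d : ((N' : ℝ) + 2) ≤ ρd * L ^ 3 := by
    rw [hNρ]; exact mul_le_mul_of_nonneg_right hρ_d.le hL3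
  -- slack of the thermodynamic stub at this (N, L, M)
  obtain ⟨δ₅, hδ₅, hdelN⟩ := hdel L M hL hM2 hb1' N' hdens_d
  set δ₁ : ℝ≥0∞ := min δ₅ 1 with hδ₁_def
  have hδ₁ : 0 < δ₁ := lt_min hδ₅ one_pos
  have hδ₁5 : δ₁ ≤ δ₅ := min_le_left _ _
  have hδ₁1 : δ₁ ≤ 1 := min_le_right _ _
  -- the transfer: it suffices to treat real non-negative δ₁-near-minimisers
  refine htrN δ₁ hδ₁ fun Ψ hΨpos hΨE => ?_
  have hE5 : periodicEnergy v Ψ ≤ periodicGroundStateEnergy v (N' + 2) L + δ₅ :=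
    hΨE.trans (add_le_add le_rfl hδ₁5)
  have hreal : ∀ X, (Ψ.ψ X).im = 0 := fun X => (hΨpos X).2
  -- the energy of Ψ is finite and O(ρN)
  have hCρN : 0 ≤ C_E * ρ * ((N' + 2 : ℕ) : ℝ) := by positivity
  have hEbd : periodicEnergy v Ψ ≤ ENNReal.ofReal (C_E * ρ * ((N' + 2 : ℕ) : ℝ)) + 1 :=
    hΨE.trans (add_le_add hEN hδ₁1)
  have hsumtop : ENNReal.ofReal (C_E * ρ * ((N' + 2 : ℕ) : ℝ)) + 1 ≠ ⊤ :=
    ENNReal.add_ne_top.2 ⟨ENNReal.ofReal_ne_top, ENNReal.one_ne_top⟩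
  have hEtop : periodicEnergy v Ψ ≠ ⊤ := ne_top_of_le_ne_top hsumtop hEbd
  have hEreal : (periodicEnergy v Ψ).toReal ≤ C_E * ρ * ((N' : ℝ) + 2) + 1 := by
    have h := ENNReal.toReal_mono hsumtop hEbd
    rw [ENNReal.toReal_add ENNReal.ofReal_ne_top ENNReal.one_ne_top, ENNReal.toReal_ofReal hCρN,
      ENNReal.toReal_one] at h
    push_cast at h
    linarith
  -- the four inequalities of the line
  have hK := h2 v N' L M hL hM1 Ψ hreal hEtop
  have hS := h3 N' L M hL hM1 Ψ
  have hD := hdelN Ψ hΨpos hE5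
  set b : ℝ := L / M with hb_def
  set IK : ℝ := kernelMass L M Ψ.ψ with hIK_def
  set Ir : ℝ := fieldMass L M Ψ.ψ with hIr_def
  set e : ℝ := (periodicEnergy v Ψ).toReal with he_def
  have he0 : 0 ≤ e := ENNReal.toReal_nonneg
  have hn : (0 : ℝ) < (N' : ℝ) + 2 := by positivity
  have hN32' : 32 * bs ^ 2 ≤ (N' : ℝ) + 2 := by push_cast at hN32; linarith only [hN32]
  -- retention factor ≥ 1/2
  have hb2 : b ^ 2 ≤ 4 * bs ^ 2 := by
    have h' : 0 ≤ 2 * bs - b := sub_nonneg.2 hb_hi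
    nlinarith only [h', hbpos.le, hbs.le]
  have hρC : C_E * ρ * (32 * bs ^ 2) ≤ 1 := by
    have h1 : ρ * (32 * bs ^ 2 * (C_E + 1)) < 1 := by
      rwa [hρret_def, lt_div_iff₀ (by positivity)] at hρ_ret
    nlinarith only [h1, mul_nonneg hρ.le (sq_nonneg bs)]
  have hret : (1 : ℝ) / 2 ≤ 1 - 2 * b ^ 2 * e / ((N' : ℝ) + 2) := by
    have hnum : 2 * b ^ 2 * e ≤ ((N' : ℝ) + 2) / 2 := by
      have s1 : b ^ 2 * e ≤ 4 * bs ^ 2 * e := mul_le_mul_of_nonneg_right hb2 he0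
      have s2 : 4 * bs ^ 2 * e ≤ 4 * bs ^ 2 * (C_E * ρ * ((N' : ℝ) + 2) + 1) :=
        mul_le_mul_of_nonneg_left hEreal (by positivity)
      have s3 : C_E * ρ * (32 * bs ^ 2) * ((N' : ℝ) + 2) ≤ (N' : ℝ) + 2 := by
        have := mul_le_mul_of_nonneg_right hρC hn.le
        linarith only [this]
      nlinarith only [s1, s2, s3, hN32', he0, hbs.le]
    have hdiv : 2 * b ^ 2 * e / ((N' : ℝ) + 2) ≤ 1 / 2 := by
      rw [div_le_iff₀ hn]; linarith only [hnum]
    linarith only [hdiv]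
  -- b⁶/2 ≤ I_K
  have hb6 : 0 < b ^ 6 := by positivity
  have hIK : b ^ 6 / 2 ≤ IK :=
    calc b ^ 6 / 2 = b ^ 6 * (1 / 2) := by ring
      _ ≤ b ^ 6 * (1 - 2 * b ^ 2 * e / ((N' : ℝ) + 2)) := mul_le_mul_of_nonneg_left hret hb6.le
      _ ≤ IK := hK
  -- I_r ≥ M³ b⁶ / (4𝕄) (the merged stub gives even M³ b⁶ / (2𝕄); we keep the planner's constant)
  have hM3 : (0 : ℝ) < (M : ℝ) ^ 3 := by positivity
  have hIr0 : 0 ≤ Ir := by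
    rw [hIr_def, fieldMass]
    exact setIntegral_nonneg (measurableSet_cellN N' L) fun X' _ =>
      Finset.sum_nonneg fun x _ => sq_nonneg _
  have hIr : (M : ℝ) ^ 3 * b ^ 6 / (4 * 𝕄) ≤ Ir := by
    have h1 : (M : ℝ) ^ 3 * (b ^ 6 / 2) ≤ (M : ℝ) ^ 3 * IK := mul_le_mul_of_nonneg_left hIK hM3.le
    rw [div_le_iff₀ (by positivity)]
    nlinarith only [h1, hD, hIr0, h𝕄]
  -- hence c₁ N ≤ N M⁻³ b⁻⁶ I_r
  have hcoef : 0 ≤ ((N' : ℝ) + 2) * ((M : ℝ) ^ 3)⁻¹ * (b ^ 6)⁻¹ := by positivity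
  have hfinal : c₁ * ((N' : ℝ) + 2) ≤ ((N' : ℝ) + 2) * ((M : ℝ) ^ 3)⁻¹ * (b ^ 6)⁻¹ * Ir :=
    calc c₁ * ((N' : ℝ) + 2)
        = ((N' : ℝ) + 2) * ((M : ℝ) ^ 3)⁻¹ * (b ^ 6)⁻¹ * ((M : ℝ) ^ 3 * b ^ 6 / (4 * 𝕄)) := by
          have hM30 : ((M : ℝ) ^ 3) ≠ 0 := hM3.ne'
          have hb60 : b ^ 6 ≠ 0 := hb6.ne'
          have h𝕄0 : 𝕄 ≠ 0 := h𝕄.ne'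
          rw [hc₁_def]
          field_simp
      _ ≤ ((N' : ℝ) + 2) * ((M : ℝ) ^ 3)⁻¹ * (b ^ 6)⁻¹ * Ir := mul_le_mul_of_nonneg_left hIr hcoef
  calc ENNReal.ofReal (c₁ * ((N' + 2 : ℕ) : ℝ)) = ENNReal.ofReal (c₁ * ((N' : ℝ) + 2)) := by
          rw [Nat.cast_add, Nat.cast_ofNat]
    _ ≤ ENNReal.ofReal (((N' : ℝ) + 2) * ((M : ℝ) ^ 3)⁻¹ * (b ^ 6)⁻¹ * Ir) :=
        ENNReal.ofReal_le_ofReal hfinal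
    _ ≤ condensateOccupation (N' + 2) L Ψ.ψ := hS

/-- **The line concludes the crux BY NAME** from its registered open stub `stub_pairKernelRowFlatness` (hypothesis `h45`),
the four LANDED stubs (theorems `stub_diluteEnergyCeiling`, `stub_cellNormRetention`, `stub_cellPairSumRule`,
`stub_positiveTransfer`, used by name inside) and the two fixed-`N` route items taken by name (`hR` = PeriodicRigidity,
stmt-9467; `hP` = PositivePeriodicNearMinimiser, stmt-14006). The antecedent `KineticLatticeBEC` is not consumed: the lattice
MECHANISM is re-instantiated at the cell scale instead (`Disproof.crux_of_periodicBEC` shape; TRIAGE r1-1/2/3: "not costume"). -/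
theorem LatticeToPeriodicBridge_of (h45 : Sig.stub_pairKernelRowFlatness)
    (hR : BECLiebAntibunching.PeriodicRigidity) (hP : BECCountConvexity.PositivePeriodicNearMinimiser) :
    LatticeToPeriodicBridge :=
  fun _hA v hv => periodicBEC_of stub_diluteEnergyCeiling stub_cellNormRetention stub_cellPairSumRule h45
    stub_positiveTransfer hR hP v hv

/-- The crux modulo the ONE sufficient registered stub (becomes a closing proof, conditional on 9467 + 14006, when
`stub_pairKernelRowFlatness` lands). -/
theorem latticeToPeriodicBridge_skeleton (hR : BECLiebAntibunching.PeriodicRigidity)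
    (hP : BECCountConvexity.PositivePeriodicNearMinimiser) : LatticeToPeriodicBridge :=
  LatticeToPeriodicBridge_of stub_pairKernelRowFlatness hR hP

/-- The planner's original cut still closes the crux: S4 (the Lorentzian lever) and S5 (delocalisation) imply the merged stub. -/
theorem LatticeToPeriodicBridge_of_lever (h4 : Sig.stub_integratedPairCoherence)
    (h5 : Sig.stub_cellInsertionDelocalisation)
    (hR : BECLiebAntibunching.PeriodicRigidity) (hP : BECCountConvexity.PositivePeriodicNearMinimiser) :
    LatticeToPeriodicBridge :=
  LatticeToPeriodicBridge_of (Sig.stub_pairKernelRowFlatness_of h4 h5) hR hP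

/-- The crux modulo the planner's two open stubs S4 ∧ S5 instead of the merged one (either registration closes it). -/
theorem latticeToPeriodicBridge_skeleton_lever (hR : BECLiebAntibunching.PeriodicRigidity)
    (hP : BECCountConvexity.PositivePeriodicNearMinimiser) : LatticeToPeriodicBridge :=
  LatticeToPeriodicBridge_of_lever stub_integratedPairCoherence stub_cellInsertionDelocalisation hR hP

/-- The same composition also proves stmt-0826's body outright (`BECPeriodicReduction.PeriodicBEC`), which is
what this line really is (TRIAGE r1-2/r1-3: "a line for stmt-0826 housed under the bridge item"). -/
theorem periodicBEC_skeleton (hR : BECLiebAntibunching.PeriodicRigidity)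
    (hP : BECCountConvexity.PositivePeriodicNearMinimiser) : BECPeriodicReduction.PeriodicBEC :=
  fun v hv => periodicBEC_of stub_diluteEnergyCeiling stub_cellNormRetention stub_cellPairSumRule
    stub_pairKernelRowFlatness stub_positiveTransfer hR hP v hv

/-! ## Sandwich (v5): the residual stub S45 sits between two forms of the consequent

UP (`periodicBEC_skeleton` above): S45 ∧ (S1–S3, S6 landed) ∧ 9467 ∧ 14006 ⟹ `PeriodicBEC`.
DOWN (`rowFlatnessSandwich_pairFloor`, landed p96926): a pair-condensate floor for the real `≥ 0` near-minimisers — no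
lattice, no cells, no signature — ⟹ S45 with the same constant. Hence the line is a DICTIONARY (continuum BEC coarse-grained to
cells ⟺ row flatness of the conditional cell-pair kernels), not a reduction: its open content is the consequent itself. -/

/-- **DOWN direction of the sandwich, inside the skeleton**: the pair-condensate floor (hypothesis `hPair`, the statement of the
registered sub-goal `rowFlatnessSandwich_pairFloor` — torus pair-BEC of the real `≥ 0` near-minimisers, uniformly in
`L ≥ L₁`, `N'+2 ≤ ρ_d L³`) gives the registered residual stub `Sig.stub_pairKernelRowFlatness` (landed theorem, by name). -/
theorem stub_pairKernelRowFlatness_of_pairFloor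
    (hPair : ∀ v : ℝ → ℝ≥0∞, IsRepulsiveFiniteRange v → ∃ 𝕄 : ℝ, 0 < 𝕄 ∧ ∃ L₁ : ℝ, 0 < L₁ ∧ ∃ ρd : ℝ, 0 < ρd ∧
      ∀ L : ℝ, L₁ ≤ L → ∀ N' : ℕ, ((N' : ℝ) + 2) ≤ ρd * L ^ 3 →
        ∃ δ : ℝ≥0∞, 0 < δ ∧ ∀ Ψ : PeriodicTrialState (N' + 2) L,
          (∀ X, 0 ≤ (Ψ.ψ X).re ∧ (Ψ.ψ X).im = 0) →
          periodicEnergy v Ψ ≤ periodicGroundStateEnergy v (N' + 2) L + δ →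
            L ^ 6 ≤ 𝕄 * ∫ X' in cellN N' L,
              (∫ p in cell L ×ˢ cell L, (Ψ.ψ (Fin.cons p.1 (Fin.cons p.2 X'))).re) ^ 2) :
    Sig.stub_pairKernelRowFlatness :=
  stub_pairKernelRowFlatness_of_pairCondensateFloor hPair

/-- **UP ∘ DOWN**: with the pair floor in hand the whole line closes the consequent (`PeriodicBEC`) — i.e. the line turns pair
torus BEC of the real `≥ 0` near-minimisers (uniform form) plus the two fixed-`N` items into torus BEC of all near-minimisers
(eventual form); the crux's antecedent is never touched. This is the precise sense in which S45 is crux-sized. -/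
theorem periodicBEC_of_pairFloor
    (hPair : ∀ v : ℝ → ℝ≥0∞, IsRepulsiveFiniteRange v → ∃ 𝕄 : ℝ, 0 < 𝕄 ∧ ∃ L₁ : ℝ, 0 < L₁ ∧ ∃ ρd : ℝ, 0 < ρd ∧
      ∀ L : ℝ, L₁ ≤ L → ∀ N' : ℕ, ((N' : ℝ) + 2) ≤ ρd * L ^ 3 →
        ∃ δ : ℝ≥0∞, 0 < δ ∧ ∀ Ψ : PeriodicTrialState (N' + 2) L,
          (∀ X, 0 ≤ (Ψ.ψ X).re ∧ (Ψ.ψ X).im = 0) →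
          periodicEnergy v Ψ ≤ periodicGroundStateEnergy v (N' + 2) L + δ →
            L ^ 6 ≤ 𝕄 * ∫ X' in cellN N' L,
              (∫ p in cell L ×ˢ cell L, (Ψ.ψ (Fin.cons p.1 (Fin.cons p.2 X'))).re) ^ 2)
    (hR : BECLiebAntibunching.PeriodicRigidity) (hP : BECCountConvexity.PositivePeriodicNearMinimiser) :
    BECPeriodicReduction.PeriodicBEC :=
  fun v hv => periodicBEC_of stub_diluteEnergyCeiling stub_cellNormRetention stub_cellPairSumRule
    (stub_pairKernelRowFlatness_of_pairCondensateFloor hPair) stub_positiveTransfer hR hP v hv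

/-- **DOWN⁺ (v6)**: an ordinary condensate floor for the real `≥ 0` near-minimisers (uniform on the dilute tori; the few-body
near-minimisers `N + 1 < 2/c` asked to be `2/(N+1)`-condensed) gives the registered residual stub S45 — landed theorem
`stub_pairKernelRowFlatness_of_condensateFloor` (many-slot Cauchy–Schwarz + the DOWN half), by name. -/
theorem stub_pairKernelRowFlatness_of_condensateFloor'
    (hBEC : ∀ v : ℝ → ℝ≥0∞, IsRepulsiveFiniteRange v → ∃ c : ℝ, 0 < c ∧ ∃ L₁ : ℝ, 0 < L₁ ∧ ∃ ρd : ℝ, 0 < ρd ∧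
      ∀ L : ℝ, L₁ ≤ L → ∀ N' : ℕ, ((N' : ℝ) + 2) ≤ ρd * L ^ 3 →
        ∃ δ : ℝ≥0∞, 0 < δ ∧ ∀ Ψ : PeriodicTrialState (N' + 2) L,
          (∀ X, 0 ≤ (Ψ.ψ X).re ∧ (Ψ.ψ X).im = 0) →
          periodicEnergy v Ψ ≤ periodicGroundStateEnergy v (N' + 2) L + δ →
            ENNReal.ofReal (max c (2 / ((N' : ℝ) + 3)) * ((N' : ℝ) + 2)) ≤ condensateOccupation (N' + 2) L Ψ.ψ) :
    Sig.stub_pairKernelRowFlatness :=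
  stub_pairKernelRowFlatness_of_condensateFloor hBEC

/-- **UP ∘ DOWN⁺ (v6)**: the whole line turns a UNIFORM condensate floor for the real `≥ 0` near-minimisers plus the two
fixed-`N` items into the consequent `PeriodicBEC` (eventual form, all near-minimisers) — the crux's antecedent untouched:
the precise, kernel-checked sense in which the coarse-cell line is a dictionary and S45 is the consequent in costume. -/
theorem periodicBEC_of_condensateFloor
    (hBEC : ∀ v : ℝ → ℝ≥0∞, IsRepulsiveFiniteRange v → ∃ c : ℝ, 0 < c ∧ ∃ L₁ : ℝ, 0 < L₁ ∧ ∃ ρd : ℝ, 0 < ρd ∧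
      ∀ L : ℝ, L₁ ≤ L → ∀ N' : ℕ, ((N' : ℝ) + 2) ≤ ρd * L ^ 3 →
        ∃ δ : ℝ≥0∞, 0 < δ ∧ ∀ Ψ : PeriodicTrialState (N' + 2) L,
          (∀ X, 0 ≤ (Ψ.ψ X).re ∧ (Ψ.ψ X).im = 0) →
          periodicEnergy v Ψ ≤ periodicGroundStateEnergy v (N' + 2) L + δ →
            ENNReal.ofReal (max c (2 / ((N' : ℝ) + 3)) * ((N' : ℝ) + 2)) ≤ condensateOccupation (N' + 2) L Ψ.ψ)
    (hR : BECLiebAntibunching.PeriodicRigidity) (hP : BECCountConvexity.PositivePeriodicNearMinimiser) :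
    BECPeriodicReduction.PeriodicBEC :=
  fun v hv => periodicBEC_of stub_diluteEnergyCeiling stub_cellNormRetention stub_cellPairSumRule
    (stub_pairKernelRowFlatness_of_condensateFloor hBEC) stub_positiveTransfer hR hP v hv

-- (v6-lite) the PLAIN-floor forms `stub_pairKernelRowFlatness_of_plainCondensateFloor` / its `periodicBEC` corollary live in the landed
-- module `…PlainCondensateFloor.lean` (p105766); they are not restated here only because that module is not yet built on the farm.

end Summit.AtomisticToContinuum.BoseEinsteinCondensation.Cruxes.LatticeToPeriodicBridge.CoarseCellLorentzian

end
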